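import Summits.AtomisticToContinuum.HydrodynamicLimit.Theses.StiffCollisionalRelaxation
import Summits.AtomisticToContinuum.HydrodynamicLimit.Theorems.StiffCollisionalRelaxationAprioriBoundsInitialTemperature
import Literature.MathematicalPhysics.KineticTheory.HardSphereEulerProofs

/-!
# Hot jams: the two docking reductions of the stub `hotJam` (line `Sketch`, crux `AprioriBounds`)

Supporting file of the line `Sketch` (card `adiabat-pricing-of-the-ceiling`) for the crux
`AprioriBounds` (stmt-AtomisticToContinuum-14827).  The registered stub `stub_hotJam` of the lead's
skeleton (`Cruxes/AprioriBounds/Lines/Sketch.lean`) asks, under the crux prefix (small `σ`, a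
classical hard-sphere Euler solution on `[0, T)` tied to the local Gibbs laws by the `t = 0` LLN, a
time `0 < t < T`, the dilute chamber `2ρσ³ < η₁` on `[0, t]`, an admissible kernel family), that for
SOME factor `M > 0` chosen right after `σ₀` the event

  HOT JAM := `∃ s ≤ t, ∃ x : 1 < ρ̄_N(s, x) σ³ ∧ ∀ s' ≤ t, ∀ y, M θ(s', y) < θ̄_N(s, x)`

(a mesoscopic block denser than `σ⁻³` AND hotter than `M` times EVERY Euler temperature on
`[0, t] × 𝕋³`; `θ̄ = (2/3)(Ē/ρ̄ − |m̄|²/(2ρ̄²))` the block temperature) has local-Gibbs probability `→ 0`.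

## Audit (this worker, cycle 2): no existing declaration produces the stub

A producer must cap the temperature of a JAMMED block uniformly in `N`, in `s ≤ t` and in the block
centre `x`, by a constant fixed BEFORE `σ`.  On a jammed block `θ̄ ≤ (2/3) Ē/ρ̄ ≤ S²/3` if every sphere
in the block is slower than `S`, so a max-speed bound at level `S_N` implies the stub iff `S_N` is
bounded — and every speed cap in the tree grows with `N`:
`KineticEnergySurgery.MaxSpeedBoundLog` = `SpeedCapSurgery.MaxSpeedBoundLog` = the visit-ledger adapter's
`VisitLedgerUpscattering.CapAt` (`C√log(N+2)`), `CornersLogPrice.MaxSpeedBoundPreShock` =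
`SinaiSteeringDichotomy.MaxSpeedBoundPreShock` (`(N+1)^{1/24}`); `KineticEnergySurgery.EquilibriumMaxSpeed`
is the constant-profile `√log` instance.  Fixed-time exponential moments
(`KineticEnergySurgery/AprioriTailsRattlers.GaussianVelocityTails`, and the time-averaged moment of
component (i)) cap `θ̄` on a block of volume `(N+1)^{-3γ}` only at `O(γ log(N+1))` (Jensen on the block +
Markov: the whole exponential budget may sit in one block), and a single time `s` is invisible to a time
average anyway; `JParityClosure.KineticEnergyTails` is a second-moment statement in expectation.
Macroscopic caps (`JParityClosure.DensityCap`, cone kernel at a FIXED radius `r`, `N → ∞` before `r → 0`;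
`EntropyBookkeeping.NoConcentration`, fixed kernel) do not see a block of mass `σ⁻³(N+1)^{-3γ} → 0`.
The sibling line's `commutator_matched_bootstrap.WindowPackage` chooses its energy cap `E₁` after
`σ, T, (ρ, u, θ), Φ, t` and is itself an unproved `Lines` stub.  Energy conservation alone gives
`θ̄ < (2/3) C K σ³ (N+1)^{3γ}` on a jam (all energy in one block), not uniform.  Hence: no `X` in the tree
with `X → stub`; the missing input is dynamical: an `N`-uniform block-temperature cap on jammed blocks,
uniform over `s ≤ t` and the block centre, with its constant fixed before `σ` (at equilibrium a static
large-deviation bound for the block fields of the low-density hard-sphere Gibbs law plus stationarity;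
out of equilibrium crux-sized — Disproof §9: the hot/cold dichotomy relocates the ceiling, it does not
shrink it).

## What is proved here (sorry-free; reductions of the explicit form `X → stub body`)

* `hotJam_of_halfCeiling` — the (ii)-CEILING half `P_N{∃ s ≤ t, ∃ x, 1 < ρ̄σ³} → 0` under the same prefix
  implies the stub with `M = 1` (monotonicity of measures).  With the analogous reduction of the cold
  half and the lead's proved `jam_dichotomy`, this records that `coldJam ∧ hotJam` re-cuts EXACTLY the
  level-`1` ceiling.
* `hotJam_of_jamTemperatureCap` — the ABSOLUTE form a large-deviation / hot-spot-envelope producer would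
  deliver: for SOME `Θ` chosen right after `σ₀` (no sign needed), `P_N{∃ s ≤ t, ∃ x, 1 < ρ̄σ³ ∧ Θ < θ̄} → 0`.
  It implies the stub with `M := max Θ 1 / θ₀(0)`: the hot clause at `(s', y) = (0, 0)` reads
  `M θ(0, 0) < θ̄`, and `θ(0, ·) = θ₀` by the LANDED identification of the Euler data through the `t = 0`
  LLN (`stub_initialTemperature`, p99956), for `σ` below its threshold and `T > 0` (here `0 < t < T`).

No new definitions (both hypotheses are written out in the stub's own binder order), no named facts;
axioms `propext`, `Classical.choice`, `Quot.sound`.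
-/

noncomputable section

open MeasureTheory Filter Set Topology
open scoped ENNReal

namespace Summit.AtomisticToContinuum.HydrodynamicLimit.Theorems.AdiabatCeiling

open Literature.MathematicalPhysics.KineticTheory Literature.Analysis.FluidPDE

/-- HOT JAM FROM THE HALF-CEILING.  If, under the crux prefix, no mesoscopic block ever reaches
`ρ̄σ³ > 1` on `[0, t]` with probability `→ 1` (the ceiling half of component (ii), stated self-contained in
the stub's binder order), then the stub `hotJam` holds with `M = 1`: the hot-jam event is contained in the
jam event (`measure_mono`) and is squeezed between `0` and a sequence tending to `0`. -/
theorem hotJam_of_halfCeiling :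
    (∀ (a₀ θ₀ : T3 → ℝ) (u₀ : T3 → V3), Continuous a₀ → Continuous θ₀ → Continuous u₀ →
      (∀ x, 0 < a₀ x) → (∀ x, 0 < θ₀ x) →
      ∃ σ₀ : ℝ, 0 < σ₀ ∧ ∃ η₁ : ℝ, 0 < η₁ ∧ ∀ σ : ℝ, 0 < σ → σ < σ₀ →
        ∀ (T : ℝ) (ρ θ : ℝ → T3 → ℝ) (u : ℝ → T3 → V3), IsHardSphereEulerSolution σ T ρ u θ →
        ∀ Φ : (N : ℕ) → HardSphereFlow (Torus.geometry (Fin 3)) (hsDiameter σ N) (N + 1),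
          TendstoHydroFieldsAt (fun N => localGibbsLaw σ a₀ u₀ θ₀ N (Φ N)) Φ ρ u θ 0 →
          ∀ t : ℝ, 0 < t → t < T → (∀ s ∈ Icc 0 t, ∀ x, 2 * ρ s x * σ ^ 3 < η₁) →
            ∀ (γ C : ℝ) (φ : ℕ → T3 → ℝ), 0 < γ → γ ≤ 1 / 15 →
              ((∀ N, Literature.Analysis.FunctionSpaces.Torus.IsSmooth (φ N)) ∧ (∀ N y, 0 ≤ φ N y) ∧
                (∀ N, ∫ y, φ N y = 1) ∧
                (∀ (N : ℕ) y, ((N : ℝ) + 1) ^ (-γ) ≤ Torus.euclidDist y 0 → φ N y = 0) ∧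
                (∀ (N : ℕ) y, φ N y ≤ C * ((N : ℝ) + 1) ^ (3 * γ)) ∧
                (∀ (N : ℕ) y, ‖Literature.Analysis.FunctionSpaces.Torus.gradient (φ N) y‖ ≤
                  C * ((N : ℝ) + 1) ^ (4 * γ))) →
              Tendsto (fun N : ℕ => localGibbsLaw σ a₀ u₀ θ₀ N (Φ N)
                {z | ∃ s ∈ Icc 0 t, ∃ x : T3,
                  1 < empiricalDensityField ((Φ N).flow s z) (fun y => φ N (y - x)) * σ ^ 3})
                atTop (𝓝 0)) →
    ∀ (a₀ θ₀ : T3 → ℝ) (u₀ : T3 → V3), Continuous a₀ → Continuous θ₀ → Continuous u₀ →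
      (∀ x, 0 < a₀ x) → (∀ x, 0 < θ₀ x) →
      ∃ σ₀ : ℝ, 0 < σ₀ ∧ ∃ M : ℝ, 0 < M ∧ ∃ η₁ : ℝ, 0 < η₁ ∧ ∀ σ : ℝ, 0 < σ → σ < σ₀ →
        ∀ (T : ℝ) (ρ θ : ℝ → T3 → ℝ) (u : ℝ → T3 → V3), IsHardSphereEulerSolution σ T ρ u θ →
        ∀ Φ : (N : ℕ) → HardSphereFlow (Torus.geometry (Fin 3)) (hsDiameter σ N) (N + 1),
          TendstoHydroFieldsAt (fun N => localGibbsLaw σ a₀ u₀ θ₀ N (Φ N)) Φ ρ u θ 0 →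
          ∀ t : ℝ, 0 < t → t < T → (∀ s ∈ Icc 0 t, ∀ x, 2 * ρ s x * σ ^ 3 < η₁) →
            ∀ (γ C : ℝ) (φ : ℕ → T3 → ℝ), 0 < γ → γ ≤ 1 / 15 →
              ((∀ N, Literature.Analysis.FunctionSpaces.Torus.IsSmooth (φ N)) ∧ (∀ N y, 0 ≤ φ N y) ∧
                (∀ N, ∫ y, φ N y = 1) ∧
                (∀ (N : ℕ) y, ((N : ℝ) + 1) ^ (-γ) ≤ Torus.euclidDist y 0 → φ N y = 0) ∧
                (∀ (N : ℕ) y, φ N y ≤ C * ((N : ℝ) + 1) ^ (3 * γ)) ∧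
                (∀ (N : ℕ) y, ‖Literature.Analysis.FunctionSpaces.Torus.gradient (φ N) y‖ ≤
                  C * ((N : ℝ) + 1) ^ (4 * γ))) →
              Tendsto (fun N : ℕ => localGibbsLaw σ a₀ u₀ θ₀ N (Φ N)
                {z | ∃ s ∈ Icc 0 t, ∃ x : T3,
                  1 < empiricalDensityField ((Φ N).flow s z) (fun y => φ N (y - x)) * σ ^ 3 ∧
                  ∀ s' ∈ Icc 0 t, ∀ y : T3,
                    M * θ s' y <
                      2 / 3 * (empiricalEnergyField ((Φ N).flow s z) (fun y => φ N (y - x)) /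
                          empiricalDensityField ((Φ N).flow s z) (fun y => φ N (y - x)) -
                        ‖empiricalMomentumField ((Φ N).flow s z) (fun y => φ N (y - x))‖ ^ 2 /
                          (2 * empiricalDensityField ((Φ N).flow s z) (fun y => φ N (y - x)) ^ 2))})
                atTop (𝓝 0) := by
  intro hceil a₀ θ₀ u₀ ha hθ hu ha0 hθ0
  obtain ⟨σ₀, hσ₀, η₁, hη₁, H⟩ := hceil a₀ θ₀ u₀ ha hθ hu ha0 hθ0
  refine ⟨σ₀, hσ₀, 1, one_pos, η₁, hη₁, ?_⟩
  intro σ hσ hσlt T ρ θ u hsol Φ hLLN t ht htT hdil γ C φ hγ hγ' hadm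
  refine tendsto_of_tendsto_of_tendsto_of_le_of_le tendsto_const_nhds
    (H σ hσ hσlt T ρ θ u hsol Φ hLLN t ht htT hdil γ C φ hγ hγ' hadm) (fun _ => zero_le)
    (fun N => measure_mono ?_)
  rintro z ⟨s, hs, x, hjam, -⟩
  exact ⟨s, hs, x, hjam⟩

/-- HOT JAM FROM AN ABSOLUTE TEMPERATURE CAP ON JAMMED BLOCKS.  If, under the crux prefix, for SOME
constant `Θ` chosen right after `σ₀` (before `η₁`, `σ` and the Euler solution; no sign condition) no
block with `ρ̄σ³ > 1` has block temperature `θ̄ > Θ` on `[0, t]`, w.h.p., then the stub `hotJam` holds with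
`M := max Θ 1 / θ₀ 0`.  Indeed a hot jam is hotter than `M θ(0, 0)`, and the Euler data's temperature IS
the profile, `θ(0, ·) = θ₀` (`stub_initialTemperature`: the `t = 0` LLN identifies the data, for `σ` below
its threshold `σ₁` and `T > 0`), so `θ̄ > max Θ 1 ≥ Θ`; take `σ₀ := min σ₁ σ₂`. -/
theorem hotJam_of_jamTemperatureCap :
    (∀ (a₀ θ₀ : T3 → ℝ) (u₀ : T3 → V3), Continuous a₀ → Continuous θ₀ → Continuous u₀ →
      (∀ x, 0 < a₀ x) → (∀ x, 0 < θ₀ x) →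
      ∃ σ₀ : ℝ, 0 < σ₀ ∧ ∃ Θ : ℝ, ∃ η₁ : ℝ, 0 < η₁ ∧ ∀ σ : ℝ, 0 < σ → σ < σ₀ →
        ∀ (T : ℝ) (ρ θ : ℝ → T3 → ℝ) (u : ℝ → T3 → V3), IsHardSphereEulerSolution σ T ρ u θ →
        ∀ Φ : (N : ℕ) → HardSphereFlow (Torus.geometry (Fin 3)) (hsDiameter σ N) (N + 1),
          TendstoHydroFieldsAt (fun N => localGibbsLaw σ a₀ u₀ θ₀ N (Φ N)) Φ ρ u θ 0 →
          ∀ t : ℝ, 0 < t → t < T → (∀ s ∈ Icc 0 t, ∀ x, 2 * ρ s x * σ ^ 3 < η₁) →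
            ∀ (γ C : ℝ) (φ : ℕ → T3 → ℝ), 0 < γ → γ ≤ 1 / 15 →
              ((∀ N, Literature.Analysis.FunctionSpaces.Torus.IsSmooth (φ N)) ∧ (∀ N y, 0 ≤ φ N y) ∧
                (∀ N, ∫ y, φ N y = 1) ∧
                (∀ (N : ℕ) y, ((N : ℝ) + 1) ^ (-γ) ≤ Torus.euclidDist y 0 → φ N y = 0) ∧
                (∀ (N : ℕ) y, φ N y ≤ C * ((N : ℝ) + 1) ^ (3 * γ)) ∧
                (∀ (N : ℕ) y, ‖Literature.Analysis.FunctionSpaces.Torus.gradient (φ N) y‖ ≤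
                  C * ((N : ℝ) + 1) ^ (4 * γ))) →
              Tendsto (fun N : ℕ => localGibbsLaw σ a₀ u₀ θ₀ N (Φ N)
                {z | ∃ s ∈ Icc 0 t, ∃ x : T3,
                  1 < empiricalDensityField ((Φ N).flow s z) (fun y => φ N (y - x)) * σ ^ 3 ∧
                  Θ < 2 / 3 * (empiricalEnergyField ((Φ N).flow s z) (fun y => φ N (y - x)) /
                        empiricalDensityField ((Φ N).flow s z) (fun y => φ N (y - x)) -
                      ‖empiricalMomentumField ((Φ N).flow s z) (fun y => φ N (y - x))‖ ^ 2 /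
                        (2 * empiricalDensityField ((Φ N).flow s z) (fun y => φ N (y - x)) ^ 2))})
                atTop (𝓝 0)) →
    ∀ (a₀ θ₀ : T3 → ℝ) (u₀ : T3 → V3), Continuous a₀ → Continuous θ₀ → Continuous u₀ →
      (∀ x, 0 < a₀ x) → (∀ x, 0 < θ₀ x) →
      ∃ σ₀ : ℝ, 0 < σ₀ ∧ ∃ M : ℝ, 0 < M ∧ ∃ η₁ : ℝ, 0 < η₁ ∧ ∀ σ : ℝ, 0 < σ → σ < σ₀ →
        ∀ (T : ℝ) (ρ θ : ℝ → T3 → ℝ) (u : ℝ → T3 → V3), IsHardSphereEulerSolution σ T ρ u θ →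
        ∀ Φ : (N : ℕ) → HardSphereFlow (Torus.geometry (Fin 3)) (hsDiameter σ N) (N + 1),
          TendstoHydroFieldsAt (fun N => localGibbsLaw σ a₀ u₀ θ₀ N (Φ N)) Φ ρ u θ 0 →
          ∀ t : ℝ, 0 < t → t < T → (∀ s ∈ Icc 0 t, ∀ x, 2 * ρ s x * σ ^ 3 < η₁) →
            ∀ (γ C : ℝ) (φ : ℕ → T3 → ℝ), 0 < γ → γ ≤ 1 / 15 →
              ((∀ N, Literature.Analysis.FunctionSpaces.Torus.IsSmooth (φ N)) ∧ (∀ N y, 0 ≤ φ N y) ∧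
                (∀ N, ∫ y, φ N y = 1) ∧
                (∀ (N : ℕ) y, ((N : ℝ) + 1) ^ (-γ) ≤ Torus.euclidDist y 0 → φ N y = 0) ∧
                (∀ (N : ℕ) y, φ N y ≤ C * ((N : ℝ) + 1) ^ (3 * γ)) ∧
                (∀ (N : ℕ) y, ‖Literature.Analysis.FunctionSpaces.Torus.gradient (φ N) y‖ ≤
                  C * ((N : ℝ) + 1) ^ (4 * γ))) →
              Tendsto (fun N : ℕ => localGibbsLaw σ a₀ u₀ θ₀ N (Φ N)
                {z | ∃ s ∈ Icc 0 t, ∃ x : T3,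
                  1 < empiricalDensityField ((Φ N).flow s z) (fun y => φ N (y - x)) * σ ^ 3 ∧
                  ∀ s' ∈ Icc 0 t, ∀ y : T3,
                    M * θ s' y <
                      2 / 3 * (empiricalEnergyField ((Φ N).flow s z) (fun y => φ N (y - x)) /
                          empiricalDensityField ((Φ N).flow s z) (fun y => φ N (y - x)) -
                        ‖empiricalMomentumField ((Φ N).flow s z) (fun y => φ N (y - x))‖ ^ 2 /
                          (2 * empiricalDensityField ((Φ N).flow s z) (fun y => φ N (y - x)) ^ 2))})
                atTop (𝓝 0) := by
  intro hcap a₀ θ₀ u₀ ha hθ hu ha0 hθ0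
  obtain ⟨σ₁, hσ₁, Hid⟩ := stub_initialTemperature a₀ θ₀ u₀ ha hθ hu ha0 hθ0
  obtain ⟨σ₂, hσ₂, Θ, η₁, hη₁, H⟩ := hcap a₀ θ₀ u₀ ha hθ hu ha0 hθ0
  have hθ00 : 0 < θ₀ 0 := hθ0 0
  refine ⟨min σ₁ σ₂, lt_min hσ₁ hσ₂, max Θ 1 / θ₀ 0,
    div_pos (lt_max_of_lt_right one_pos) hθ00, η₁, hη₁, ?_⟩
  intro σ hσ hσlt T ρ θ u hsol Φ hLLN t ht htT hdil γ C φ hγ hγ' hadm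
  have hσ1 : σ < σ₁ := hσlt.trans_le (min_le_left _ _)
  have hσ2 : σ < σ₂ := hσlt.trans_le (min_le_right _ _)
  have hid : θ 0 0 = θ₀ 0 := (Hid σ hσ hσ1 T ρ θ u hsol (ht.trans htT) Φ hLLN 0).1
  have hM : max Θ 1 / θ₀ 0 * θ 0 0 = max Θ 1 := by
    rw [hid, div_mul_cancel₀ _ hθ00.ne']
  refine tendsto_of_tendsto_of_tendsto_of_le_of_le tendsto_const_nhds
    (H σ hσ hσ2 T ρ θ u hsol Φ hLLN t ht htT hdil γ C φ hγ hγ' hadm) (fun _ => zero_le)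
    (fun N => measure_mono ?_)
  rintro z ⟨s, hs, x, hjam, hhot⟩
  refine ⟨s, hs, x, hjam, ?_⟩
  have h0 := hhot 0 ⟨le_rfl, ht.le⟩ 0
  rw [hM] at h0
  exact (le_max_left Θ 1).trans_lt h0

end Summit.AtomisticToContinuum.HydrodynamicLimit.Theorems.AdiabatCeiling
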